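import Literature.MathematicalPhysics.QuantumManyBody.PeriodicBoseGasTagged
import Literature.MathematicalPhysics.QuantumManyBody.BoseGasProductState
import HarnessLib

/-!
# The periodic Bose gas: relabelling invariance on the torus cell

Topic `Literature/MathematicalPhysics/QuantumManyBody` (companion of `PeriodicBoseGas.lean`,
`PeriodicBoseGasTagged.lean` and of the Dirichlet-box file `BoseGasProductState.lean`, whose
relabelling map `relabelCLM σ : X ↦ X ∘ σ`, `kineticDensity_comp_perm` and `lintegral_comp_perm`
it transports to the torus `[0,L)^{3M}`). Tools for `BosonicFloor.lean` (bosonic = absolute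
ground-state energy on the torus).

* `sum_norm_sq_comp_perm`, `sum_norm_sq_comp_perm_add_single` : the symmetrised square modulus
  `∑_σ ‖f(X ∘ σ)‖²` is invariant under relabelling and inherits the lattice periodicity of `f`;
* `comp_perm_mem_cellN_iff`, `setLIntegral_cellN_comp_perm` : the cell `[0,L)^{3M}` and Lebesgue
  measure restricted to it are invariant under `X ↦ X ∘ σ`;
* `two_mul_periodicInteraction`, `periodicInteraction_comp_perm` : `2∑_{i<j} v^per(xᵢ - xⱼ) =
  ∑_{i≠j} v^per(xᵢ - xⱼ)` (`v^per` is even, `periodizedPotential_sub_comm`), whence the periodic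
  pair interaction [Fournais2020, (1.1)] is invariant under relabelling the particles;
* `periodicGroundStateEnergy_mul_lintegral_le` : the variational principle for UNNORMALISED
  admissible functions, `E^per(M, L) · ∫_{cell}|ψ|² ≤ ∫_{cell}(|∇ψ|² + ∑_{i<j} v^per |ψ|²)`
  [Fournais2020, (1.2)].

## References

* [Fournais2020] S. Fournais, *Length scales for BEC in the dilute Bose gas*, arXiv:2011.00309:
  (1.1)–(1.2) (the torus Hamiltonian and its ground-state energy).
* [LSSY2005] E. H. Lieb, R. Seiringer, J. P. Solovej, J. Yngvason, *The Mathematics of the Bose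
  Gas and its Condensation*, Birkhäuser 2005, Ch. 2 (2.1).
-/

noncomputable section

open MeasureTheory Filter Topology
open scoped ENNReal NNReal

namespace Literature.MathematicalPhysics.QuantumManyBody.BoseGas

variable {M : ℕ} {L : ℝ}

/-! ### Relabelling invariance on the torus -/

/-- The symmetrised square modulus `∑_σ ‖f(X ∘ σ)‖²` is invariant under relabelling
(re-index `σ ↦ τσ`). [folklore] -/
theorem sum_norm_sq_comp_perm (f : Config M → ℂ) (τ : Equiv.Perm (Fin M)) (X : Config M) :
    (∑ σ : Equiv.Perm (Fin M), ‖f ((X ∘ τ) ∘ σ)‖ ^ 2) = ∑ σ : Equiv.Perm (Fin M), ‖f (X ∘ σ)‖ ^ 2 :=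
  Equiv.sum_comp (Equiv.mulLeft τ) (fun ρ : Equiv.Perm (Fin M) => ‖f (X ∘ ρ)‖ ^ 2)

/-- The symmetrised square modulus of a function periodic in every particle and axis is periodic.
[folklore] -/
theorem sum_norm_sq_comp_perm_add_single {f : Config M → ℂ}
    (hper : ∀ (X : Config M) (i : Fin M) (k : Fin 3),
      f (X + Pi.single i (EuclideanSpace.single k L)) = f X)
    (X : Config M) (i : Fin M) (k : Fin 3) :
    (∑ σ : Equiv.Perm (Fin M), ‖f ((X + Pi.single i (EuclideanSpace.single k L)) ∘ σ)‖ ^ 2) =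
      ∑ σ : Equiv.Perm (Fin M), ‖f (X ∘ σ)‖ ^ 2 := by
  refine Finset.sum_congr rfl fun σ _ => ?_
  have h : (X + Pi.single i (EuclideanSpace.single k L)) ∘ σ =
      X ∘ σ + Pi.single (σ.symm i) (EuclideanSpace.single k L) := by
    rw [← single_comp_perm σ i]; rfl
  rw [h, hper]

/-- `X ↦ f(X ∘ σ)` is `Cⁿ` when `f` is. [folklore] -/
theorem contDiff_comp_perm {f : Config M → ℂ} {n : WithTop ℕ∞} (hf : ContDiff ℝ n f)
    (σ : Equiv.Perm (Fin M)) : ContDiff ℝ n fun X : Config M => f (X ∘ σ) :=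
  hf.comp (relabelCLM σ).contDiff

/-- `X ↦ X ∘ σ` is measurable. [folklore] -/
theorem measurable_comp_perm_config (σ : Equiv.Perm (Fin M)) :
    Measurable fun X : Config M => X ∘ σ :=
  (relabelCLM σ).continuous.measurable

/-- `X ∘ σ ∈ [0,L)^{3M} ↔ X ∈ [0,L)^{3M}`. [folklore] -/
theorem comp_perm_mem_cellN_iff (σ : Equiv.Perm (Fin M)) (X : Config M) :
    X ∘ σ ∈ cellN M L ↔ X ∈ cellN M L :=
  σ.forall_congr_right (q := fun i => X i ∈ cell L)

/-- **Lebesgue measure on the cell is invariant under relabelling**: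
`∫_{[0,L)^{3M}} G(X ∘ σ) dX = ∫_{[0,L)^{3M}} G`.  Same statement as `lintegral_cellN_comp_perm`
(`PeriodicBoseGasThm31.lean`); kept under this name (many Summits files use it) as a one-line
pointer (dedup-01336) — prefer `lintegral_cellN_comp_perm` in new code. [folklore] -/
theorem setLIntegral_cellN_comp_perm (σ : Equiv.Perm (Fin M)) (G : Config M → ℝ≥0∞) :
    ∫⁻ X in cellN M L, G (X ∘ σ) = ∫⁻ X in cellN M L, G X :=
  lintegral_cellN_comp_perm σ G

/-- The periodic pair interaction as half the sum over ORDERED pairs: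
`2 ∑_{i<j} v^per(xᵢ - xⱼ) = ∑_{i ≠ j} v^per(xᵢ - xⱼ)` (`v^per` is even). [folklore] -/
theorem two_mul_periodicInteraction (v : ℝ → ℝ≥0∞) (L : ℝ) (X : Config M) :
    2 * periodicInteraction v L X =
      ∑ i : Fin M, ∑ j : Fin M with j ≠ i, periodizedPotential v L (X i - X j) := by
  unfold periodicInteraction
  have hsymm : ∑ i : Fin M, ∑ j : Fin M with i < j, periodizedPotential v L (X i - X j) =
      ∑ i : Fin M, ∑ j : Fin M with j < i, periodizedPotential v L (X i - X j) := by
    simp only [Finset.sum_filter]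
    rw [Finset.sum_comm]
    refine Finset.sum_congr rfl fun i _ => Finset.sum_congr rfl fun j _ => ?_
    rw [periodizedPotential_sub_comm]
  have hsplit : ∀ i : Fin M, ∑ j : Fin M with j ≠ i, periodizedPotential v L (X i - X j) =
      (∑ j : Fin M with i < j, periodizedPotential v L (X i - X j)) +
        ∑ j : Fin M with j < i, periodizedPotential v L (X i - X j) := by
    intro i
    simp only [Finset.sum_filter, ← Finset.sum_add_distrib]
    refine Finset.sum_congr rfl fun j _ => ?_
    rcases lt_trichotomy i j with h | h | h
    · simp [h, ne_of_gt h, not_lt_of_gt h]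
    · simp [h]
    · simp [h, ne_of_lt h, not_lt_of_gt h]
  simp only [hsplit, Finset.sum_add_distrib, ← hsymm, two_mul]

/-- **The periodic interaction is invariant under relabelling the particles.** [folklore] -/
theorem periodicInteraction_comp_perm (v : ℝ → ℝ≥0∞) (L : ℝ) (σ : Equiv.Perm (Fin M))
    (X : Config M) : periodicInteraction v L (X ∘ σ) = periodicInteraction v L X := by
  have h2 : (2 : ℝ≥0∞) ≠ 0 := two_ne_zero
  have key : 2 * periodicInteraction v L (X ∘ σ) = 2 * periodicInteraction v L X := by
    rw [two_mul_periodicInteraction, two_mul_periodicInteraction]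
    simp only [Function.comp_apply, Finset.sum_filter]
    rw [← Equiv.sum_comp σ (fun i => ∑ j, if j ≠ i then periodizedPotential v L (X i - X j) else 0)]
    refine Finset.sum_congr rfl fun i _ => ?_
    rw [← Equiv.sum_comp σ (fun j => if j ≠ σ i then periodizedPotential v L (X (σ i) - X j) else 0)]
    refine Finset.sum_congr rfl fun j _ => ?_
    simp only [ne_eq, σ.injective.eq_iff]
  exact (ENNReal.mul_right_inj h2 ENNReal.ofNat_ne_top).1 key

/-- The periodised potential of a measurable profile is measurable. [folklore] -/
private theorem measurable_periodizedPotential_floor {v : ℝ → ℝ≥0∞} (hv : Measurable v) (L : ℝ) :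
    Measurable (periodizedPotential v L) := by
  show Measurable fun x => ∑' n : Fin 3 → ℤ, v ‖x - latticeVec L n‖
  exact Measurable.tsum fun n => hv.comp (measurable_id.sub_const _).norm

/-- The periodic pair interaction of a measurable profile is measurable. [folklore] -/
private theorem measurable_periodicInteraction_floor {v : ℝ → ℝ≥0∞} (hv : Measurable v) (L : ℝ) :
    Measurable fun X : Config M => periodicInteraction v L X := by
  unfold periodicInteraction
  refine Finset.measurable_sum _ fun i _ => Finset.measurable_sum _ fun j _ => ?_
  exact (measurable_periodizedPotential_floor hv L).comp
    ((measurable_pi_apply i).sub (measurable_pi_apply j))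

/-- **Variational principle for unnormalised functions.** For every `C¹`, `Lℤ³`-periodic,
Bose-symmetric `ψ` with `∫_{cell} |ψ|² < ∞`:
`E^per(M, L) · ∫_{cell} |ψ|² ≤ ∫_{cell} (|∇ψ|² + ∑_{i<j} v^per |ψ|²)` (normalise `ψ`; if
`∫|ψ|² = 0` there is nothing to prove). [cite: Fournais2020, (1.2)] -/
theorem periodicGroundStateEnergy_mul_lintegral_le (v : ℝ → ℝ≥0∞) {ψ : Config M → ℂ}
    (hC : ContDiff ℝ 1 ψ)
    (hper : ∀ (X : Config M) (i : Fin M) (k : Fin 3),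
      ψ (X + Pi.single i (EuclideanSpace.single k L)) = ψ X)
    (hsymm : ∀ (σ : Equiv.Perm (Fin M)) (X : Config M), ψ (X ∘ σ) = ψ X)
    (htop : ∫⁻ X in cellN M L, ((‖ψ X‖₊ : ℝ≥0∞)) ^ 2 ≠ ⊤) :
    periodicGroundStateEnergy v M L * ∫⁻ X in cellN M L, ((‖ψ X‖₊ : ℝ≥0∞)) ^ 2 ≤
      ∫⁻ X in cellN M L,
        (kineticDensity ψ X + periodicInteraction v L X * ((‖ψ X‖₊ : ℝ≥0∞)) ^ 2) := by
  set m := ∫⁻ X in cellN M L, ((‖ψ X‖₊ : ℝ≥0∞)) ^ 2 with hm_def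
  rcases eq_or_ne m 0 with hm0 | hm0
  · simp [hm0]
  have hmpos : 0 < m.toReal := ENNReal.toReal_pos hm0 htop
  set c : ℝ := Real.sqrt (m.toReal)⁻¹ with hc_def
  have hc0 : 0 ≤ c := Real.sqrt_nonneg _
  have hc2 : ENNReal.ofReal (c ^ 2) = m⁻¹ := by
    rw [hc_def, Real.sq_sqrt (inv_nonneg.2 hmpos.le), ENNReal.ofReal_inv_of_pos hmpos,
      ENNReal.ofReal_toReal htop]
  -- the normalised trial state
  let Ψ : PeriodicTrialState M L :=
    { ψ := fun X => (c : ℂ) * ψ X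
      contDiff := contDiff_const.mul hC
      periodic := fun X i k => by rw [hper]
      symm := fun σ X => by rw [hsymm]
      norm_eq := by
        simp only [ennorm_real_mul_sq c hc0]
        rw [lintegral_const_mul' _ _ ENNReal.ofReal_ne_top, hc2]
        exact ENNReal.inv_mul_cancel hm0 htop }
  have hE : periodicEnergy v Ψ = m⁻¹ * ∫⁻ X in cellN M L,
      (kineticDensity ψ X + periodicInteraction v L X * ((‖ψ X‖₊ : ℝ≥0∞)) ^ 2) := by
    unfold periodicEnergy
    rw [← hc2, ← lintegral_const_mul' _ _ ENNReal.ofReal_ne_top]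
    refine lintegral_congr fun X => ?_
    change kineticDensity (fun X => (c : ℂ) * ψ X) X + periodicInteraction v L X *
      ((‖(c : ℂ) * ψ X‖₊ : ℝ≥0∞)) ^ 2 = _
    rw [kineticDensity_const_mul hC c hc0, ennorm_real_mul_sq c hc0]
    ring
  calc periodicGroundStateEnergy v M L * m ≤ periodicEnergy v Ψ * m :=
        mul_le_mul_left (periodicGroundStateEnergy_le v Ψ) m
    _ = ∫⁻ X in cellN M L,
          (kineticDensity ψ X + periodicInteraction v L X * ((‖ψ X‖₊ : ℝ≥0∞)) ^ 2) := by
        rw [hE, mul_comm, ← mul_assoc, ENNReal.mul_inv_cancel hm0 htop, one_mul]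

end Literature.MathematicalPhysics.QuantumManyBody.BoseGas

end
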